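import Literature.Geometry.Kaehler.MilnorSymbolCocycle
import Literature.Geometry.Kaehler.MatrixFormLocalCalculus
import Literature.AlgebraicGeometry.Modules.CechCup
import HarnessLib

/-!
# Cup step for `SymbolLiftR` (route `MilnorKExponential`), 0: the product of chains and the Čech–de Rham cup product

Helper file for the stub `stub_cupStep` (S3) of the line `lefschetz-fold` of the crux `SymbolLiftR`
(item stmt-HodgeConjecture-18702); this file holds the DEFINITIONS of the package and their
elementary calculus:

* `mulChain p s u` — the product `(Σ a_t [t]) · (Σ b_g [g]) = Σ a_t b_g [(t, g)]` of a chain of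
  `p`-tuples of functions with a chain of `1`-tuples, concatenating (`Fin.snoc`): the elementary-tensor
  multiplication `(𝒪^×)^{⊗p} × 𝒪^× → (𝒪^×)^{⊗(p+1)}` on free abelian groups (Milnor (1971), §11),
  biadditive (`mulChainHom`);
* `cupZero x y`, `cupOne hU x y` — the cup product on the Čech–de Rham complex
  `CechForms I A U a b = C^a(𝔘, Ω^b)` of `Literature.Geometry.Kaehler.CechDeRham` with a weight-one
  factor: `(x ∪ y)_i = x_i ∧ y_i` for `0`-cochains, and `(x ∪ y)_J = x_{J₀…J_a}|_{U_J} ∧ y_{J_a J_{a+1}}`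
  for a `1`-cochain `y` on the back edge `Cech.back a J` of
  `Literature.AlgebraicGeometry.Modules.CechCup` (Bott–Tu (1982), §8: the product structure on
  `C^•(𝔘, Ω^•)`);
* the front-face / back-edge index identities of ordered tuples in the orientation used by the
  Leibniz computations of the companion files (from `Modules/CechCup`).

Everything is proved; no named facts.

## References

* R. Bott, L. W. Tu, *Differential Forms in Algebraic Topology* (1982), §8 (8.4), Prop. 8.8.
* J. Milnor, *Introduction to Algebraic K-Theory* (1971), §11, Thm. 11.1.
* F. W. Warner, *Foundations of Differentiable Manifolds and Lie Groups* (1983), 2.6, 2.17.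
-/

noncomputable section

-- the mandated namespace `Summit.HodgeConjecture.HodgeConjecture.…` repeats a component
set_option linter.dupNamespace false

open scoped Manifold ContDiff

namespace Summit.HodgeConjecture.HodgeConjecture.Theorems.SymbolLiftR

open Literature.Geometry.Kaehler Literature.NumberTheory.Transcendental
open Literature.AlgebraicGeometry.Modules

namespace CupStep

/-! ### Index identities: front face and back edge of an ordered tuple -/

section FinFacts

variable {κ : Type*}

/-- Front face after deleting the vertex `castSucc k`:
`(γ ∘ σ_{castSucc k}) ∘ castSucc = (γ ∘ castSucc) ∘ σ_k`. [folklore] -/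
theorem front_comp_succAbove_castSucc {n : ℕ} (γ : Fin (n + 3) → κ) (k : Fin (n + 2)) :
    (γ ∘ Fin.succAbove (Fin.castSucc k)) ∘ Fin.castSucc = (γ ∘ Fin.castSucc) ∘ Fin.succAbove k := by
  change γ ∘ (Fin.succAbove (Fin.castSucc k) ∘ Fin.castSucc) = (γ ∘ Fin.castSucc) ∘ Fin.succAbove k
  rw [Cech.succAbove_castSucc_comp_castSucc]
  rfl

/-- The back edge of an `(n+3)`-tuple is face `0` of its back triangle. [folklore] -/
theorem back_succ_eq_backThree {n : ℕ} (γ : Fin (n + 3) → κ) :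
    Cech.back (n + 1) γ = Cech.backThree n γ ∘ Fin.succAbove 0 :=
  (Cech.backThree_comp_succAbove_zero γ).symm

/-- The back edge of the tuple with the vertex `n + 1` deleted is face `1` of the back triangle.
[folklore] -/
theorem back_comp_succAbove_castSucc_last {n : ℕ} (γ : Fin (n + 3) → κ) :
    Cech.back n (γ ∘ Fin.succAbove (Fin.castSucc (Fin.last (n + 1)))) =
      Cech.backThree n γ ∘ Fin.succAbove 1 :=
  (Cech.backThree_comp_succAbove_one γ).symm

/-- The back edge of the tuple with the last vertex deleted is face `2` of the back triangle.
[folklore] -/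
theorem back_comp_castSucc {n : ℕ} (γ : Fin (n + 3) → κ) :
    Cech.back n (γ ∘ Fin.castSucc) = Cech.backThree n γ ∘ Fin.succAbove 2 := by
  rw [← Fin.succAbove_last]
  exact (Cech.backThree_comp_succAbove_two γ).symm

/-- The back edge of a `2`-tuple is the tuple. [folklore] -/
theorem back_zero (J : Fin 2 → κ) : Cech.back 0 J = J := by
  funext j
  change J (Fin.natAdd 0 j) = J j
  congr 1
  ext
  simp

end FinFacts

/-! ### The product of chains of symbols: `[f₁,…,f_p] · [g] = [f₁,…,f_p,g]` -/

section Chains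

variable {M : Type*}

/-- **The product of chains** `(Σ a_t [t]) · (Σ b_g [g]) = Σ a_t b_g [(t, g)]`, concatenating a
`p`-tuple of functions with a `1`-tuple (`Fin.snoc`): the elementary-tensor multiplication
`(𝒪^×)^{⊗p} × 𝒪^× → (𝒪^×)^{⊗(p+1)}` on free abelian groups (Milnor (1971), §11). [folklore] -/
def mulChain (p : ℕ) (s : (Fin p → M → ℂ) →₀ ℤ) (u : (Fin 1 → M → ℂ) →₀ ℤ) :
    (Fin (p + 1) → M → ℂ) →₀ ℤ :=
  s.sum fun t a ↦ u.sum fun g b ↦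
    Finsupp.single (Fin.snoc t (g 0) : Fin (p + 1) → M → ℂ) (a * b)

/-- The product with a single tuple on the left. [folklore] -/
theorem mulChain_single_left (p : ℕ) (t : Fin p → M → ℂ) (a : ℤ) (u : (Fin 1 → M → ℂ) →₀ ℤ) :
    mulChain p (Finsupp.single t a) u =
      u.sum fun g b ↦ Finsupp.single (Fin.snoc t (g 0) : Fin (p + 1) → M → ℂ) (a * b) := by
  unfold mulChain
  refine Finsupp.sum_single_index ?_
  simp only [zero_mul, Finsupp.single_zero, Finsupp.sum_fun_zero]

/-- The product of two single tuples is the single concatenated tuple. [folklore] -/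
theorem mulChain_single_single (p : ℕ) (t : Fin p → M → ℂ) (a : ℤ) (g : Fin 1 → M → ℂ) (b : ℤ) :
    mulChain p (Finsupp.single t a) (Finsupp.single g b) =
      Finsupp.single (Fin.snoc t (g 0) : Fin (p + 1) → M → ℂ) (a * b) := by
  rw [mulChain_single_left]
  refine Finsupp.sum_single_index ?_
  rw [mul_zero, Finsupp.single_zero]

/-- The product is additive on the left. [folklore] -/
theorem mulChain_add_left (p : ℕ) (s s' : (Fin p → M → ℂ) →₀ ℤ) (u : (Fin 1 → M → ℂ) →₀ ℤ) :
    mulChain p (s + s') u = mulChain p s u + mulChain p s' u := by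
  unfold mulChain
  refine Finsupp.sum_add_index' (fun t ↦ ?_) (fun t a a' ↦ ?_)
  · simp only [zero_mul, Finsupp.single_zero, Finsupp.sum_fun_zero]
  · simp only [add_mul, Finsupp.single_add, Finsupp.sum_add]

/-- The product is additive on the right. [folklore] -/
theorem mulChain_add_right (p : ℕ) (s : (Fin p → M → ℂ) →₀ ℤ) (u u' : (Fin 1 → M → ℂ) →₀ ℤ) :
    mulChain p s (u + u') = mulChain p s u + mulChain p s u' := by
  unfold mulChain
  rw [← Finsupp.sum_add]
  refine Finsupp.sum_congr fun t _ ↦ ?_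
  refine Finsupp.sum_add_index' (fun g ↦ ?_) (fun g b b' ↦ ?_)
  · rw [mul_zero, Finsupp.single_zero]
  · rw [mul_add, Finsupp.single_add]

/-- The product as a biadditive map. [folklore] -/
def mulChainHom (p : ℕ) :
    ((Fin p → M → ℂ) →₀ ℤ) →+ ((Fin 1 → M → ℂ) →₀ ℤ) →+ ((Fin (p + 1) → M → ℂ) →₀ ℤ) :=
  AddMonoidHom.mk' (fun s ↦ AddMonoidHom.mk' (mulChain p s) (mulChain_add_right p s))
    fun s s' ↦ AddMonoidHom.ext fun u ↦ mulChain_add_left p s s' u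

/-- `mulChainHom` is `mulChain` (definitional). [folklore] -/
@[simp]
theorem mulChainHom_apply (p : ℕ) (s : (Fin p → M → ℂ) →₀ ℤ) (u : (Fin 1 → M → ℂ) →₀ ℤ) :
    mulChainHom p s u = mulChain p s u :=
  rfl

/-- The product with zero on the left. [folklore] -/
theorem mulChain_zero_left (p : ℕ) (u : (Fin 1 → M → ℂ) →₀ ℤ) :
    mulChain p (0 : (Fin p → M → ℂ) →₀ ℤ) u = 0 :=
  map_zero ((mulChainHom (M := M) p).flip u)

/-- The product with zero on the right. [folklore] -/
theorem mulChain_zero_right (p : ℕ) (s : (Fin p → M → ℂ) →₀ ℤ) :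
    mulChain p s (0 : (Fin 1 → M → ℂ) →₀ ℤ) = 0 :=
  map_zero (mulChainHom (M := M) p s)

/-- The product with a negative on the left. [folklore] -/
theorem mulChain_neg_left (p : ℕ) (s : (Fin p → M → ℂ) →₀ ℤ) (u : (Fin 1 → M → ℂ) →₀ ℤ) :
    mulChain p (-s) u = -mulChain p s u :=
  map_neg ((mulChainHom (M := M) p).flip u) s

/-- The product with a negative on the right. [folklore] -/
theorem mulChain_neg_right (p : ℕ) (s : (Fin p → M → ℂ) →₀ ℤ) (u : (Fin 1 → M → ℂ) →₀ ℤ) :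
    mulChain p s (-u) = -mulChain p s u :=
  map_neg (mulChainHom (M := M) p s) u

/-- The product with a difference on the left. [folklore] -/
theorem mulChain_sub_left (p : ℕ) (s s' : (Fin p → M → ℂ) →₀ ℤ) (u : (Fin 1 → M → ℂ) →₀ ℤ) :
    mulChain p (s - s') u = mulChain p s u - mulChain p s' u :=
  map_sub ((mulChainHom (M := M) p).flip u) s s'

/-- The product with a difference on the right. [folklore] -/
theorem mulChain_sub_right (p : ℕ) (s : (Fin p → M → ℂ) →₀ ℤ) (u u' : (Fin 1 → M → ℂ) →₀ ℤ) :
    mulChain p s (u - u') = mulChain p s u - mulChain p s u' :=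
  map_sub (mulChainHom (M := M) p s) u u'

/-- The product with an integer multiple on the left. [folklore] -/
theorem mulChain_zsmul_left (p : ℕ) (z : ℤ) (s : (Fin p → M → ℂ) →₀ ℤ) (u : (Fin 1 → M → ℂ) →₀ ℤ) :
    mulChain p (z • s) u = z • mulChain p s u :=
  map_zsmul ((mulChainHom (M := M) p).flip u) z s

/-- The product with an integer multiple on the right. [folklore] -/
theorem mulChain_zsmul_right (p : ℕ) (z : ℤ) (s : (Fin p → M → ℂ) →₀ ℤ) (u : (Fin 1 → M → ℂ) →₀ ℤ) :
    mulChain p s (z • u) = z • mulChain p s u :=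
  map_zsmul (mulChainHom (M := M) p s) z u

/-- The product with a finite sum on the left. [folklore] -/
theorem mulChain_sum_left {β : Type*} (p : ℕ) (S : Finset β) (f : β → (Fin p → M → ℂ) →₀ ℤ)
    (u : (Fin 1 → M → ℂ) →₀ ℤ) : mulChain p (∑ i ∈ S, f i) u = ∑ i ∈ S, mulChain p (f i) u :=
  map_sum ((mulChainHom (M := M) p).flip u) f S

/-- The product with a finite sum on the right. [folklore] -/
theorem mulChain_sum_right {β : Type*} (p : ℕ) (s : (Fin p → M → ℂ) →₀ ℤ) (S : Finset β)
    (f : β → (Fin 1 → M → ℂ) →₀ ℤ) : mulChain p s (∑ i ∈ S, f i) = ∑ i ∈ S, mulChain p s (f i) :=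
  map_sum (mulChainHom (M := M) p s) f S

/-- `V_J ⊆ U_{f ∘ J}` for a refinement `V_k ⊆ U_{f k}` of families of sets. [folklore] -/
theorem cechSet_subset_cechSet_comp {ι κ : Type*} {U : ι → Set M} {V : κ → Set M} {f : κ → ι}
    (hf : ∀ k, V k ⊆ U (f k)) {m : ℕ} (J : Fin m → κ) : cechSet V J ⊆ cechSet U (f ∘ J) :=
  fun _ hx ↦ mem_cechSet_iff.2 fun k ↦ hf _ (mem_cechSet_iff.1 hx k)

/-- `b · [t] = b • [t]` (one-tuple multiples). [folklore] -/
theorem single_eq_zsmul {α : Type*} (x : α) (b : ℤ) :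
    Finsupp.single x b = b • Finsupp.single x 1 := by
  rw [Finsupp.smul_single', mul_one]

end Chains

/-! ### The Čech–de Rham cup product with a weight-one cochain -/

section Forms

variable {E : Type*} [NormedAddCommGroup E] [NormedSpace ℝ E] {H : Type*} [TopologicalSpace H]
  {I : ModelWithCorners ℝ E H} {M : Type*} [TopologicalSpace M] [ChartedSpace H M]
  {A : Type*} [NormedCommRing A] [NormedAlgebra ℝ A] {κ : Type*} {U : κ → Set M}

/-- **The cup product of a `0`-cochain of `c`-forms with a `0`-cochain of `1`-forms**:
`(x ∪ y)_i = x_i ∧ y_i` (Bott–Tu (1982), the product structure on `C^•(𝔘, Ω^•)`).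
[cite: BottTu1982Forms, §8 (8.4)] -/
def cupZero {c : ℕ} (x : CechForms I A U 0 c) (y : CechForms I A U 0 1) : CechForms I A U 0 (c + 1) :=
  fun J ↦ ⟨(x J : MForm I M A c).wedge (y J : MForm I M A 1),
    fun z hz ↦ ((x J).2.1 z hz).wedge ((y J).2.1 z hz),
    fun z hz ↦ by
      rw [MForm.wedge_apply, (x J).2.2 z hz]
      exact ContinuousAlternatingMap.zero_wedge _⟩

/-- The cup product of `0`-cochains on underlying forms. [folklore] -/
@[simp]
theorem coe_cupZero {c : ℕ} (x : CechForms I A U 0 c) (y : CechForms I A U 0 1) (J : Fin 1 → κ) :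
    (cupZero x y J : MForm I M A (c + 1)) = (x J : MForm I M A c).wedge (y J : MForm I M A 1) :=
  rfl

/-- **The cup product of an `a`-cochain of `c`-forms (front face) with a `1`-cochain of `1`-forms
(back edge)**: `(x ∪ y)_J = x_{J₀…J_a}|_{U_J} ∧ y_{J_a J_{a+1}}` (Bott–Tu (1982), the product structure
on the Čech–de Rham complex). [cite: BottTu1982Forms, §8 (8.4)] -/
def cupOne (hU : ∀ i, IsOpen (U i)) {a c : ℕ} (x : CechForms I A U a c) (y : CechForms I A U 1 1) :
    CechForms I A U (a + 1) (c + 1) :=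
  fun J ↦ ⟨((x (J ∘ Fin.castSucc) : MForm I M A c).restr (cechSet U J)).wedge
      (y (Cech.back a J) : MForm I M A 1),
    fun z hz ↦ ((MForm.smoothAt_restr_iff (isOpen_cechSet hU J) _ hz).2
        ((x _).2.1 z (cechSet_subset_comp U J Fin.castSucc hz))).wedge
      ((y _).2.1 z (cechSet_subset_comp U J (Fin.natAdd a (m := 2)) hz)),
    fun z hz ↦ by
      rw [MForm.wedge_apply, MForm.restr_apply_of_notMem _ hz]
      exact ContinuousAlternatingMap.zero_wedge _⟩

/-- The cup product with a `1`-cochain on underlying forms. [folklore] -/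
theorem coe_cupOne (hU : ∀ i, IsOpen (U i)) {a c : ℕ} (x : CechForms I A U a c) (y : CechForms I A U 1 1)
    (J : Fin (a + 2) → κ) :
    (cupOne hU x y J : MForm I M A (c + 1)) =
      ((x (J ∘ Fin.castSucc) : MForm I M A c).restr (cechSet U J)).wedge
        (y (Cech.back a J) : MForm I M A 1) :=
  rfl

/-- The cup product at a point of `U_J`. [folklore] -/
theorem cupOne_apply_of_mem (hU : ∀ i, IsOpen (U i)) {a c : ℕ} (x : CechForms I A U a c)
    (y : CechForms I A U 1 1) {J : Fin (a + 2) → κ} {z : M} (hz : z ∈ cechSet U J) :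
    (cupOne hU x y J : MForm I M A (c + 1)) z =
      (letI u : E [⋀^Fin c]→L[ℝ] A := (x (J ∘ Fin.castSucc) : MForm I M A c) z
       letI v : E [⋀^Fin 1]→L[ℝ] A := (y (Cech.back a J) : MForm I M A 1) z
       (u.wedge v : E [⋀^Fin (c + 1)]→L[ℝ] A)) := by
  change (((x (J ∘ Fin.castSucc) : MForm I M A c).restr (cechSet U J)).wedge
    (y (Cech.back a J) : MForm I M A 1)) z = _
  rw [MForm.wedge_apply, MForm.restr_apply_of_mem _ hz]

end Forms

end CupStep

/-- STUB `stub_cupStepDefs` (registered sub-goal of item stmt-HodgeConjecture-18702, anchoring this helper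
file): **the product of two single tuples is the single concatenated tuple**,
`[t] · [g] = [(t, g)]` with multiplicities multiplied (`CupStep.mulChain_single_single`). [folklore] -/
theorem stub_cupStepDefs : ∀ {M : Type*} (p : ℕ) (t : Fin p → M → ℂ) (a : ℤ) (g : Fin 1 → M → ℂ) (b : ℤ), CupStep.mulChain p (Finsupp.single t a) (Finsupp.single g b) = Finsupp.single (Fin.snoc t (g 0) : Fin (p + 1) → M → ℂ) (a * b) :=
  fun p t a g b ↦ CupStep.mulChain_single_single p t a g b

end Summit.HodgeConjecture.HodgeConjecture.Theorems.SymbolLiftR
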